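import Summits.ValiantsHypothesis.ValiantsHypothesis.Theorems.KPlusLogSqLawLiftingExactPatchwork
import Summits.ValiantsHypothesis.ValiantsHypothesis.Theorems.KPlusLogSqLawLiftingPatchworkCoefficients

/-!
# Patchworking is EXACT at large base: the real zero count of a Viro pencil equals the design's alternation count

HONEST FRAMING.  Helper file (part 4 of 4) toward the lifting crux `WeakLifting` (stmt-ValiantsHypothesis-19561; aside `Lifting`
stmt-ValiantsHypothesis-19772) of route `KPlusLogSqLaw` (cell `pub-symmetroid`, seat val-sym-lift-p2 g3, 2026-08-26).  A PENCIL-LEVEL, TWO-SIDED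
lifting statement in the TROPICAL LIMIT only; it asserts nothing about `WeakLifting`, `TropicalB`, Conjecture B in the window,
`MatrixDescartes` (stmt-ValiantsHypothesis-18050) or VP ≠ VNP, and it is NOT a format-level statement (the cell's `TropRow`/`RealRootLawAt`
currencies are maxima over designs / pencils).

THEOREM (`card_posRoots_patch_eq_card_alternating`).  Let `(d, v, ε)` be a tropical design (`|ε| ≤ 1`) of format `(m, K)` and let
`P₀, …, P_r` be present Leibniz terms with strictly increasing slopes `D(P_j)`, consecutive ones TYING at strictly increasing integer
parameters `θ₀ < ⋯ < θ_{r−1}` with every other present term STRICTLY lighter there (the pair `P_k, P_{k+1}` is jointly dominant at `θ_k`),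
all present slopes in `[D(P₀), D(P_r)]`, and each `P_j` of least valuation in its slope class — i.e. `(P_j)` is the vertex chain of the
design's upper envelope, with integer breakpoints.  Then for every base `b ≥ 16 · N · (D(P_r) + 1) · 4^{D(P_r)}` (`N = #Leibniz terms`)
the patchworked real pencil `Σ_l X^{d_l} · patchMatrix b v ε l` has EXACTLY `#{k : termSign P_k · termSign P_{k+1} < 0}` distinct
positive zeros of its determinant.  The tree's `MatrixDescartes.Negative.le_card_posRoots_patch` is the lower half (at integer
dominant slopes); the upper half is new: in the tropical limit the real count of a pencil is EXACTLY its tropical count, so every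
real EXCESS over a design's alternation count (Li–Wang; census (2,4): 9 real > 8 tropical) lives at finite base, inside merged windows
— the object a lifting lemma for the window has to control (GAP-LIFT §3 of val-sym-lift-p4, mechanisms M2/M3).
PROOF.  `ExactPatchwork.card_posRoots_eq_card_alternating` (part 2) with vertex exponents `D(P_j)` and windows `[b^{θ_k}/4, 4·b^{θ_k}]`:
at `x = b^{θ_k} ρ^{±1}` a competitor's mass is `b^{weight} ρ^{±D} ≤ b^{W−1} 4^{D(P_r)}` (integer margin), the tying vertices weigh
`b^W 4^{∓D}` and are separated by a factor `4` (slopes differ by `≥ 1`), and vertex coefficients are `≥ b^{−V}/2` in size with the sign of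
their term (part 3); the four endpoint inequalities (D), (M) of part 2 reduce to `4N·4^D < b` and `2N·D·4^D < b`.
[folklore] (quantitative one-variable Viro patchworking; no single source).
-/

set_option linter.dupNamespace false
set_option autoImplicit false

namespace Summit.ValiantsHypothesis.ValiantsHypothesis.Theorems.KPlusLogSqLaw.ExactPatchwork

open Polynomial Finset
open scoped BigOperators
open Summit.ValiantsHypothesis.ValiantsHypothesis.Theorems.MatrixDescartes.Negative
  (patchMatrix tropWeight termSign prod_zpow_eq_zpow_sum_patch abs_termSign_eq_one)

variable {m K : ℕ}

/-- **PATCHWORKING IS EXACT AT LARGE BASE (pencil-level two-sided lifting in the tropical limit).**  Let `(d, v, ε)` be a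
tropical design (`|ε| ≤ 1`) and let `P₀, …, P_r` be present Leibniz terms with strictly increasing slopes `D(P_j) = Σᵢ d(λᵢ)`,
tying consecutively at strictly increasing INTEGER slopes `θ₀ < ⋯ < θ_{r−1}` (`P_k`, `P_{k+1}` have equal tropical weight at
`θ_k`) where every other present term is strictly lighter (the pair is jointly dominant at `θ_k`), such that every present
term has slope in `[D(P₀), D(P_r)]` and every other present term of slope `D(P_j)` has larger valuation than `P_j` — i.e.
`P₀, …, P_r` is the full vertex chain of the design's upper envelope.  Then for every base
`b ≥ 16 · N · (D(P_r) + 1) · 4^{D(P_r)}` (`N = m!·K^m` the number of Leibniz terms) the patchworked real pencil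
`Σ_l X^{d_l} · patchMatrix b v ε l` has EXACTLY `#{k : termSign P_k · termSign P_{k+1} < 0}` distinct positive zeros of its
determinant: the tree's lower bound `le_card_posRoots_patch` is an equality in the tropical limit, so every real excess over a
design's alternation count lives at finite base.  Proof: `card_posRoots_eq_card_alternating` with vertex chain `D(P_j)` and
windows `[b^{θ_k}/4, 4 b^{θ_k}]`; (D) and (M) follow from the weight margins (`≥ 1`, integrality) since a competitor's mass at
`x = b^{θ} ρ^{±1}` is `b^{weight} ρ^{±D} ≤ b^{W−1} 4^{D(P_r)}` against `b^{W} 4^{∓D}/2` for the vertex. [folklore] -/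
theorem card_posRoots_patch_eq_card_alternating (b : ℝ) (d : Fin K → ℕ) (v ε : Fin m → Fin m → Fin K → ℤ)
    (hε : ∀ i j l, (ε i j l).natAbs ≤ 1) (r : ℕ) (P : Fin (r + 1) → Equiv.Perm (Fin m) × (Fin m → Fin K))
    (θ : Fin r → ℤ) (hθ : StrictMono θ) (hP : ∀ j, termSign ε (P j) ≠ 0)
    (hslope : StrictMono (fun j => ∑ i, d ((P j).2 i)))
    (htie : ∀ k : Fin r, tropWeight d v (θ k) (P k.succ) = tropWeight d v (θ k) (P k.castSucc))
    (hmargin : ∀ (k : Fin r) (Q : Equiv.Perm (Fin m) × (Fin m → Fin K)), termSign ε Q ≠ 0 →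
      Q ≠ P k.castSucc → Q ≠ P k.succ → tropWeight d v (θ k) Q < tropWeight d v (θ k) (P k.castSucc))
    (hrange : ∀ Q : Equiv.Perm (Fin m) × (Fin m → Fin K), termSign ε Q ≠ 0 →
      (∑ i, d ((P 0).2 i)) ≤ (∑ i, d (Q.2 i)) ∧ (∑ i, d (Q.2 i)) ≤ ∑ i, d ((P (Fin.last r)).2 i))
    (huniq : ∀ (j : Fin (r + 1)) (Q : Equiv.Perm (Fin m) × (Fin m → Fin K)), termSign ε Q ≠ 0 → Q ≠ P j →
      (∑ i, d (Q.2 i)) = (∑ i, d ((P j).2 i)) →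
        (∑ i, v ((P j).1 i) i ((P j).2 i)) + 1 ≤ ∑ i, v (Q.1 i) i (Q.2 i))
    (hb : 16 * (Fintype.card (Equiv.Perm (Fin m) × (Fin m → Fin K)) : ℝ)
      * ((∑ i, d ((P (Fin.last r)).2 i) : ℕ) + 1 : ℝ) * 4 ^ (∑ i, d ((P (Fin.last r)).2 i)) ≤ b) :
    (((∑ l, (X : ℝ[X]) ^ d l • (patchMatrix b v ε l).map C).det).roots.toFinset.filter (fun t => 0 < t)).card
      = (Finset.univ.filter (fun k : Fin r => termSign ε (P k.castSucc) * termSign ε (P k.succ) < 0)).card := by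
  classical
  set f := ((∑ l, (X : ℝ[X]) ^ d l • (patchMatrix b v ε l).map C).det) with hf
  set N : ℝ := (Fintype.card (Equiv.Perm (Fin m) × (Fin m → Fin K)) : ℝ) with hN
  set Dm : ℕ := ∑ i, d ((P (Fin.last r)).2 i) with hDm
  set vtx : Fin (r + 1) → ℕ := fun j => ∑ i, d ((P j).2 i) with hvtx
  set pp : Fin r → ℝ := fun k => b ^ θ k * 4⁻¹ with hpp
  set qq : Fin r → ℝ := fun k => b ^ θ k * 4 with hqq
  /- size facts -/
  have hN1 : 1 ≤ N := by rw [hN]; exact_mod_cast Fintype.card_pos_iff.mpr ⟨P 0⟩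
  have h4Dm : (1 : ℝ) ≤ 4 ^ Dm := one_le_pow₀ (by norm_num)
  have hDm0 : (0 : ℝ) ≤ (Dm : ℝ) := Nat.cast_nonneg _
  have hA1 : N ≤ N * 4 ^ Dm := le_mul_of_one_le_right (by linarith) h4Dm
  have hAD : 0 ≤ N * 4 ^ Dm * (Dm : ℝ) := by positivity
  have hb' : 16 * (N * 4 ^ Dm) + 16 * (N * 4 ^ Dm * (Dm : ℝ)) ≤ b := by
    have : 16 * N * ((Dm : ℝ) + 1) * 4 ^ Dm = 16 * (N * 4 ^ Dm) + 16 * (N * 4 ^ Dm * (Dm : ℝ)) := by ring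
    linarith
  have hbA : 4 * N * 4 ^ Dm < b := by
    have : 4 * N * 4 ^ Dm = 4 * (N * 4 ^ Dm) := by ring
    linarith
  have hbB : 2 * N * (Dm : ℝ) * 4 ^ Dm < b := by
    have : 2 * N * (Dm : ℝ) * 4 ^ Dm = 2 * (N * 4 ^ Dm * (Dm : ℝ)) := by ring
    linarith
  have hbN : 2 * N ≤ b := by linarith
  have hb16 : (16 : ℝ) ≤ b := by linarith
  have hb1 : (1 : ℝ) ≤ b := by linarith
  have hb0 : (0 : ℝ) < b := by linarith
  /- slopes of present terms are at most `Dm`, vertex slopes too -/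
  have hDle : ∀ Q, termSign ε Q ≠ 0 → (∑ i, d (Q.2 i)) ≤ Dm := fun Q hQ => (hrange Q hQ).2
  have hvle : ∀ j, vtx j ≤ Dm := fun j => hDle (P j) (hP j)
  /- the vertex coefficients: sign and size -/
  have hcoef : ∀ j, b ^ (-(∑ i, v ((P j).1 i) i ((P j).2 i))) / 2 ≤ (termSign ε (P j) : ℝ) * f.coeff (vtx j) :=
    fun j => half_le_termSign_mul_coeff b d v ε hε (P j) (hP j) (huniq j) (by rw [← hN]; exact hbN)
  have habs : ∀ j, b ^ (-(∑ i, v ((P j).1 i) i ((P j).2 i))) / 2 ≤ |f.coeff (vtx j)| := by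
    intro j
    refine (hcoef j).trans ?_
    have h1 : |(termSign ε (P j) : ℝ) * f.coeff (vtx j)| = |f.coeff (vtx j)| := by
      rw [abs_mul, abs_termSign_eq_one ε hε (P j) (hP j), one_mul]
    rw [← h1]; exact le_abs_self _
  have hvs : ∀ j, vtx j ∈ f.support := by
    intro j
    rw [Polynomial.mem_support_iff]
    intro h0
    have := habs j
    rw [h0, abs_zero] at this
    exact absurd this (not_le.mpr (by positivity))
  /- vertex mass identity at a test point `x = b^{θ k} ρ₀` -/
  have hvmass : ∀ (j : Fin (r + 1)) (k : Fin r) (ρ₀ : ℝ), 0 < ρ₀ →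
      b ^ tropWeight d v (θ k) (P j) * ρ₀ ^ (vtx j) / 2 ≤ |f.coeff (vtx j)| * (b ^ θ k * ρ₀) ^ (vtx j) := by
    intro j k ρ₀ hρ₀
    have hid := zpow_neg_mul_pow_eq b hb0 d v (θ k) ρ₀ (P j)
    have hxpos : 0 < (b ^ θ k * ρ₀) ^ (vtx j) := pow_pos (mul_pos (zpow_pos hb0 _) hρ₀) _
    calc b ^ tropWeight d v (θ k) (P j) * ρ₀ ^ (vtx j) / 2
        = (b ^ (-(∑ i, v ((P j).1 i) i ((P j).2 i))) / 2) * (b ^ θ k * ρ₀) ^ (vtx j) := by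
          rw [← hid]; ring
      _ ≤ |f.coeff (vtx j)| * (b ^ θ k * ρ₀) ^ (vtx j) := mul_le_mul_of_nonneg_right (habs j) hxpos.le
  /- integer margins -/
  have hmar' : ∀ (k : Fin r) (Q : Equiv.Perm (Fin m) × (Fin m → Fin K)), termSign ε Q ≠ 0 →
      Q ≠ P k.castSucc → Q ≠ P k.succ → tropWeight d v (θ k) Q ≤ tropWeight d v (θ k) (P k.castSucc) - 1 := by
    intro k Q hQ h1 h2; have := hmargin k Q hQ h1 h2; omega
  have husucc : ∀ k : Fin r, vtx k.castSucc + 1 ≤ vtx k.succ := fun k => hslope (Fin.castSucc_lt_succ)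
  /- the key numeric facts (`ρ = 4`) -/
  have h4pos : (0 : ℝ) < 4 := by norm_num
  have hq0 : (0 : ℝ) < 4⁻¹ := by norm_num
  have hq1 : (4⁻¹ : ℝ) ≤ 1 := by norm_num
  have hpow_le : ∀ {u : ℕ}, u ≤ Dm → (4 : ℝ) ^ u ≤ 4 ^ Dm := fun hu => pow_le_pow_right₀ (by norm_num) hu
  have hinvpow : ∀ u : ℕ, (4⁻¹ : ℝ) ^ u = (4 ^ u)⁻¹ := fun u => inv_pow _ _
  -- K1: `N / b < (4^u)⁻¹ / 4` for `u ≤ Dm`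
  have hK1 : ∀ {u : ℕ}, u ≤ Dm → N * b⁻¹ < (4⁻¹ : ℝ) ^ u / 4 := by
    intro u hu
    have h4u : (0 : ℝ) < 4 ^ u := pow_pos h4pos u
    have h2 : 4 * N * 4 ^ u < b :=
      lt_of_le_of_lt (mul_le_mul_of_nonneg_left (hpow_le hu) (by positivity)) hbA
    have h3 : N / b < 1 / (4 * 4 ^ u) := by
      rw [div_lt_div_iff₀ hb0 (by positivity)]; linarith
    rw [hinvpow, ← div_eq_mul_inv]
    calc N / b < 1 / (4 * 4 ^ u) := h3
      _ = (4 ^ u)⁻¹ / 4 := by field_simp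
  -- K2: `N · 4^Dm / b < 1/4`
  have hK2 : N * b⁻¹ * 4 ^ Dm < 1 / 4 := by
    have h3 : N * 4 ^ Dm / b < 1 / 4 := by
      rw [div_lt_div_iff₀ hb0 h4pos]; linarith
    calc N * b⁻¹ * 4 ^ Dm = N * 4 ^ Dm / b := by ring
      _ < 1 / 4 := h3
  -- K3: `N · Dm / b < (4^u)⁻¹ / 2` for `u ≤ Dm`
  have hK3 : ∀ {u : ℕ}, u ≤ Dm → N * (Dm : ℝ) * b⁻¹ < (4⁻¹ : ℝ) ^ u / 2 := by
    intro u hu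
    have h4u : (0 : ℝ) < 4 ^ u := pow_pos h4pos u
    have h2 : 2 * N * (Dm : ℝ) * 4 ^ u < b :=
      lt_of_le_of_lt (mul_le_mul_of_nonneg_left (hpow_le hu) (by positivity)) hbB
    have h3 : N * (Dm : ℝ) / b < 1 / (2 * 4 ^ u) := by
      rw [div_lt_div_iff₀ hb0 (by positivity)]; linarith
    rw [hinvpow, ← div_eq_mul_inv]
    calc N * (Dm : ℝ) / b < 1 / (2 * 4 ^ u) := h3
      _ = (4 ^ u)⁻¹ / 2 := by field_simp
  -- K4: `N · Dm · 4^Dm / b < 1/2`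
  have hK4 : N * (Dm : ℝ) * b⁻¹ * 4 ^ Dm < 1 / 2 := by
    have h3 : N * (Dm : ℝ) * 4 ^ Dm / b < 1 / 2 := by
      rw [div_lt_div_iff₀ hb0 (by norm_num : (0:ℝ) < 2)]; linarith
    calc N * (Dm : ℝ) * b⁻¹ * 4 ^ Dm = N * (Dm : ℝ) * 4 ^ Dm / b := by ring
      _ < 1 / 2 := h3
  have hbW : ∀ W : ℤ, b ^ (W - 1) = b ^ W * b⁻¹ := fun W => by
    rw [sub_eq_add_neg, zpow_add₀ hb0.ne', zpow_neg_one]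
  /- slope bounds inside the support: `|s − u| ≤ Dm` -/
  have hφΦ : ∀ (u : ℕ), u ≤ Dm → ∀ s ∈ f.support, |(s : ℝ) - u| ≤ (Dm : ℝ) := by
    intro u hu s hs
    obtain ⟨p, hp, hps⟩ := exists_present_of_mem_support b hb0 d v ε hs
    have hsD : s ≤ Dm := hps ▸ hDle p hp
    rw [abs_sub_le_iff]
    constructor
    · have : (s : ℝ) ≤ Dm := by exact_mod_cast hsD
      have : (0 : ℝ) ≤ u := Nat.cast_nonneg _
      linarith
    · have : (u : ℝ) ≤ Dm := by exact_mod_cast hu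
      have : (0 : ℝ) ≤ s := Nat.cast_nonneg _
      linarith
  /- (D) at the left end of window `k`: vertex `P k` dominates at `b^{θ_k}/4` -/
  have hDl : ∀ k : Fin r, ∑ s ∈ f.support.erase (vtx k.castSucc), |f.coeff s| * pp k ^ s
      < |f.coeff (vtx k.castSucc)| * pp k ^ vtx k.castSucc := by
    intro k
    have hmarg : ∀ p : Equiv.Perm (Fin m) × (Fin m → Fin K), termSign ε p ≠ 0 → p ≠ P k.succ →
        (∑ i, d (p.2 i)) ∈ f.support.erase (vtx k.castSucc) →
        tropWeight d v (θ k) p ≤ tropWeight d v (θ k) (P k.castSucc) - 1 := by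
      intro p hp hne hT
      have hDu : (∑ i, d (p.2 i)) ≠ vtx k.castSucc := (Finset.mem_erase.mp hT).1
      exact hmar' k p hp (fun h => hDu (by rw [h])) hne
    have hM := mass_le_vertex_add b hb1 d v ε hε (θ k) (tropWeight d v (θ k) (P k.castSucc)) hq0
      (f.support.erase (vtx k.castSucc)) (fun _ => (1 : ℝ)) (fun _ => zero_le_one) zero_le_one
      (fun _ _ => le_rfl) (c := 1) (fun p _ => pow_le_one₀ hq0.le hq1) zero_le_one (P k.succ) (hP _) (htie k) hmarg
    simp only [one_mul, mul_one] at hM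
    have hR := hvmass k.castSucc k 4⁻¹ hq0
    refine lt_of_le_of_lt hM (lt_of_lt_of_le ?_ hR)
    have hBW : 0 < b ^ tropWeight d v (θ k) (P k.castSucc) := zpow_pos hb0 _
    have hs : (4⁻¹ : ℝ) ^ vtx k.succ ≤ (4⁻¹ : ℝ) ^ vtx k.castSucc / 4 := by
      have := pow_le_pow_of_le_one hq0.le hq1 (husucc k)
      rw [pow_succ] at this
      linarith
    have hNb := hK1 (hvle k.castSucc)
    rw [hbW]
    nlinarith [mul_le_mul_of_nonneg_left hs hBW.le, mul_lt_mul_of_pos_left hNb hBW]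
  /- (D) at the right end of window `k`: vertex `P (k+1)` dominates at `4 b^{θ_k}` -/
  have hDr : ∀ k : Fin r, ∑ s ∈ f.support.erase (vtx k.succ), |f.coeff s| * qq k ^ s
      < |f.coeff (vtx k.succ)| * qq k ^ vtx k.succ := by
    intro k
    have hmarg : ∀ p : Equiv.Perm (Fin m) × (Fin m → Fin K), termSign ε p ≠ 0 → p ≠ P k.castSucc →
        (∑ i, d (p.2 i)) ∈ f.support.erase (vtx k.succ) →
        tropWeight d v (θ k) p ≤ tropWeight d v (θ k) (P k.castSucc) - 1 := by
      intro p hp hne hT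
      have hDw : (∑ i, d (p.2 i)) ≠ vtx k.succ := (Finset.mem_erase.mp hT).1
      exact hmar' k p hp hne (fun h => hDw (by rw [h]))
    have hM := mass_le_vertex_add b hb1 d v ε hε (θ k) (tropWeight d v (θ k) (P k.castSucc)) h4pos
      (f.support.erase (vtx k.succ)) (fun _ => (1 : ℝ)) (fun _ => zero_le_one) zero_le_one
      (fun _ _ => le_rfl) (c := 4 ^ Dm) (fun p hp => hpow_le (hDle p hp)) (by positivity) (P k.castSucc) (hP _) rfl
      hmarg
    simp only [one_mul] at hM
    have hR := hvmass k.succ k 4 h4pos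
    rw [htie k] at hR
    refine lt_of_le_of_lt hM (lt_of_lt_of_le ?_ hR)
    have hBW : 0 < b ^ tropWeight d v (θ k) (P k.castSucc) := zpow_pos hb0 _
    have hs : (4 : ℝ) ^ vtx k.castSucc ≤ (4 : ℝ) ^ vtx k.succ / 4 := by
      have := pow_le_pow_right₀ (by norm_num : (1:ℝ) ≤ 4) (husucc k)
      rw [pow_succ] at this
      linarith
    have ht : (1 : ℝ) ≤ 4 ^ vtx k.succ := one_le_pow₀ (by norm_num)
    rw [hbW]
    nlinarith [mul_le_mul_of_nonneg_left hs hBW.le, mul_lt_mul_of_pos_left hK2 hBW,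
      mul_le_mul_of_nonneg_left ht hBW.le]
  /- (M) at the left end of window `k` -/
  have hMl : ∀ k : Fin r, ∑ s ∈ (f.support.erase (vtx k.castSucc)).erase (vtx k.succ),
      |(s : ℝ) - vtx k.castSucc| * |f.coeff s| * pp k ^ s
        < ((vtx k.succ : ℝ) - vtx k.castSucc) * |f.coeff (vtx k.succ)| * pp k ^ vtx k.succ := by
    intro k
    have hmarg : ∀ p : Equiv.Perm (Fin m) × (Fin m → Fin K), termSign ε p ≠ 0 →
        (∑ i, d (p.2 i)) ∈ (f.support.erase (vtx k.castSucc)).erase (vtx k.succ) →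
        tropWeight d v (θ k) p ≤ tropWeight d v (θ k) (P k.castSucc) - 1 := by
      intro p hp hT
      obtain ⟨hDw, hT'⟩ := Finset.mem_erase.mp hT
      have hDu : (∑ i, d (p.2 i)) ≠ vtx k.castSucc := (Finset.mem_erase.mp hT').1
      exact hmar' k p hp (fun h => hDu (by rw [h])) (fun h => hDw (by rw [h]))
    have hTsub : ∀ s ∈ (f.support.erase (vtx k.castSucc)).erase (vtx k.succ), |(s : ℝ) - vtx k.castSucc| ≤ (Dm : ℝ) :=
      fun s hs => hφΦ (vtx k.castSucc) (hvle _) s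
        (Finset.mem_of_mem_erase (Finset.mem_of_mem_erase hs))
    have hM := mass_le_of_margin b hb1 d v ε hε (θ k) (tropWeight d v (θ k) (P k.castSucc)) hq0
      ((f.support.erase (vtx k.castSucc)).erase (vtx k.succ)) (fun s => |(s : ℝ) - vtx k.castSucc|)
      (fun _ => abs_nonneg _) hDm0 hTsub (c := 1) (fun p _ => pow_le_one₀ hq0.le hq1) zero_le_one hmarg
    simp only [mul_one] at hM
    have hR := hvmass k.succ k 4⁻¹ hq0
    rw [htie k] at hR
    have hBW : 0 < b ^ tropWeight d v (θ k) (P k.castSucc) := zpow_pos hb0 _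
    have hwu : (1 : ℝ) ≤ (vtx k.succ : ℝ) - vtx k.castSucc := by
      have := husucc k
      have : ((vtx k.castSucc : ℕ) : ℝ) + 1 ≤ (vtx k.succ : ℕ) := by exact_mod_cast this
      linarith
    have hNb := hK3 (hvle k.succ)
    have hRpos : 0 ≤ |f.coeff (vtx k.succ)| * pp k ^ vtx k.succ :=
      mul_nonneg (abs_nonneg _) (pow_nonneg (mul_pos (zpow_pos hb0 _) hq0).le _)
    refine lt_of_le_of_lt hM ?_
    rw [hbW]
    calc (Fintype.card (Equiv.Perm (Fin m) × (Fin m → Fin K)) : ℝ)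
          * ((Dm : ℝ) * (b ^ tropWeight d v (θ k) (P k.castSucc) * b⁻¹))
        = b ^ tropWeight d v (θ k) (P k.castSucc) * (N * (Dm : ℝ) * b⁻¹) := by rw [hN]; ring
      _ < b ^ tropWeight d v (θ k) (P k.castSucc) * ((4⁻¹ : ℝ) ^ vtx k.succ / 2) := mul_lt_mul_of_pos_left hNb hBW
      _ = b ^ tropWeight d v (θ k) (P k.castSucc) * (4⁻¹ : ℝ) ^ vtx k.succ / 2 := by ring
      _ ≤ |f.coeff (vtx k.succ)| * pp k ^ vtx k.succ := hR
      _ = 1 * (|f.coeff (vtx k.succ)| * pp k ^ vtx k.succ) := by ring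
      _ ≤ ((vtx k.succ : ℝ) - vtx k.castSucc) * (|f.coeff (vtx k.succ)| * pp k ^ vtx k.succ) :=
          mul_le_mul_of_nonneg_right hwu hRpos
      _ = ((vtx k.succ : ℝ) - vtx k.castSucc) * |f.coeff (vtx k.succ)| * pp k ^ vtx k.succ := by ring
  /- (M) at the right end of window `k` -/
  have hMr : ∀ k : Fin r, ∑ s ∈ (f.support.erase (vtx k.castSucc)).erase (vtx k.succ),
      |(s : ℝ) - vtx k.castSucc| * |f.coeff s| * qq k ^ s
        < ((vtx k.succ : ℝ) - vtx k.castSucc) * |f.coeff (vtx k.succ)| * qq k ^ vtx k.succ := by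
    intro k
    have hmarg : ∀ p : Equiv.Perm (Fin m) × (Fin m → Fin K), termSign ε p ≠ 0 →
        (∑ i, d (p.2 i)) ∈ (f.support.erase (vtx k.castSucc)).erase (vtx k.succ) →
        tropWeight d v (θ k) p ≤ tropWeight d v (θ k) (P k.castSucc) - 1 := by
      intro p hp hT
      obtain ⟨hDw, hT'⟩ := Finset.mem_erase.mp hT
      have hDu : (∑ i, d (p.2 i)) ≠ vtx k.castSucc := (Finset.mem_erase.mp hT').1
      exact hmar' k p hp (fun h => hDu (by rw [h])) (fun h => hDw (by rw [h]))
    have hTsub : ∀ s ∈ (f.support.erase (vtx k.castSucc)).erase (vtx k.succ), |(s : ℝ) - vtx k.castSucc| ≤ (Dm : ℝ) :=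
      fun s hs => hφΦ (vtx k.castSucc) (hvle _) s
        (Finset.mem_of_mem_erase (Finset.mem_of_mem_erase hs))
    have hM := mass_le_of_margin b hb1 d v ε hε (θ k) (tropWeight d v (θ k) (P k.castSucc)) h4pos
      ((f.support.erase (vtx k.castSucc)).erase (vtx k.succ)) (fun s => |(s : ℝ) - vtx k.castSucc|)
      (fun _ => abs_nonneg _) hDm0 hTsub (c := 4 ^ Dm) (fun p hp => hpow_le (hDle p hp)) (by positivity) hmarg
    have hR := hvmass k.succ k 4 h4pos
    rw [htie k] at hR
    have hBW : 0 < b ^ tropWeight d v (θ k) (P k.castSucc) := zpow_pos hb0 _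
    have hwu : (1 : ℝ) ≤ (vtx k.succ : ℝ) - vtx k.castSucc := by
      have := husucc k
      have : ((vtx k.castSucc : ℕ) : ℝ) + 1 ≤ (vtx k.succ : ℕ) := by exact_mod_cast this
      linarith
    have ht : (1 : ℝ) ≤ 4 ^ vtx k.succ := one_le_pow₀ (by norm_num)
    have hRpos : 0 ≤ |f.coeff (vtx k.succ)| * qq k ^ vtx k.succ :=
      mul_nonneg (abs_nonneg _) (pow_nonneg (mul_pos (zpow_pos hb0 _) h4pos).le _)
    refine lt_of_le_of_lt hM ?_
    rw [hbW]
    calc (Fintype.card (Equiv.Perm (Fin m) × (Fin m → Fin K)) : ℝ)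
          * ((Dm : ℝ) * (b ^ tropWeight d v (θ k) (P k.castSucc) * b⁻¹) * 4 ^ Dm)
        = b ^ tropWeight d v (θ k) (P k.castSucc) * (N * (Dm : ℝ) * b⁻¹ * 4 ^ Dm) := by rw [hN]; ring
      _ < b ^ tropWeight d v (θ k) (P k.castSucc) * (1 / 2) := mul_lt_mul_of_pos_left hK4 hBW
      _ ≤ b ^ tropWeight d v (θ k) (P k.castSucc) * (4 ^ vtx k.succ / 2) := by
          refine mul_le_mul_of_nonneg_left ?_ hBW.le; linarith
      _ = b ^ tropWeight d v (θ k) (P k.castSucc) * (4 : ℝ) ^ vtx k.succ / 2 := by ring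
      _ ≤ |f.coeff (vtx k.succ)| * qq k ^ vtx k.succ := hR
      _ = 1 * (|f.coeff (vtx k.succ)| * qq k ^ vtx k.succ) := by ring
      _ ≤ ((vtx k.succ : ℝ) - vtx k.castSucc) * (|f.coeff (vtx k.succ)| * qq k ^ vtx k.succ) :=
          mul_le_mul_of_nonneg_right hwu hRpos
      _ = ((vtx k.succ : ℝ) - vtx k.castSucc) * |f.coeff (vtx k.succ)| * qq k ^ vtx k.succ := by ring
  /- the remaining hypotheses of the exact count -/
  have hmin : ∀ s ∈ f.support, vtx 0 ≤ s := by
    intro s hs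
    obtain ⟨p, hp, hps⟩ := exists_present_of_mem_support b hb0 d v ε hs
    exact hps ▸ (hrange p hp).1
  have hmax : ∀ s ∈ f.support, s ≤ vtx (Fin.last r) := by
    intro s hs
    obtain ⟨p, hp, hps⟩ := exists_present_of_mem_support b hb0 d v ε hs
    exact hps ▸ (hrange p hp).2
  have hp : ∀ k, 0 < pp k := fun k => mul_pos (zpow_pos hb0 _) hq0
  have hpq : ∀ k, pp k ≤ qq k := fun k =>
    mul_le_mul_of_nonneg_left (by norm_num) (zpow_pos hb0 _).le
  have hqp : ∀ k k' : Fin r, k < k' → qq k ≤ pp k' := by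
    intro k k' hkk'
    have h1 : θ k + 1 ≤ θ k' := hθ hkk'
    have h2 : b ^ (θ k + 1) ≤ b ^ θ k' := zpow_le_zpow_right₀ hb1 h1
    rw [zpow_add_one₀ hb0.ne'] at h2
    have h3 : b ^ θ k * 4 * 4 ≤ b ^ θ k * b := by nlinarith [zpow_pos hb0 (θ k)]
    show b ^ θ k * 4 ≤ b ^ θ k' * 4⁻¹
    rw [le_mul_inv_iff₀ h4pos]
    linarith
  have hcount := card_posRoots_eq_card_alternating f r vtx pp qq hslope hvs hmin hmax hp hpq hqp hDl hDr hMl hMr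
  rw [hcount]
  -- the signs of the vertex coefficients are those of the vertex terms
  refine congrArg Finset.card (Finset.filter_congr fun k _ => ?_)
  have h1 := hcoef k.castSucc
  have h2 := hcoef k.succ
  have hp1 : 0 < (termSign ε (P k.castSucc) : ℝ) * f.coeff (vtx k.castSucc) := lt_of_lt_of_le (by positivity) h1
  have hp2 : 0 < (termSign ε (P k.succ) : ℝ) * f.coeff (vtx k.succ) := lt_of_lt_of_le (by positivity) h2
  have hprod : 0 < ((termSign ε (P k.castSucc) : ℝ) * (termSign ε (P k.succ) : ℝ))
      * (f.coeff (vtx k.castSucc) * f.coeff (vtx k.succ)) := by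
    have := mul_pos hp1 hp2
    have heq : ((termSign ε (P k.castSucc) : ℝ) * f.coeff (vtx k.castSucc)) * ((termSign ε (P k.succ) : ℝ) * f.coeff (vtx k.succ))
        = ((termSign ε (P k.castSucc) : ℝ) * (termSign ε (P k.succ) : ℝ)) * (f.coeff (vtx k.castSucc) * f.coeff (vtx k.succ)) := by
      ring
    rw [heq] at this; exact this
  have hcast : ((termSign ε (P k.castSucc) * termSign ε (P k.succ) : ℤ) : ℝ)
      = (termSign ε (P k.castSucc) : ℝ) * (termSign ε (P k.succ) : ℝ) := by push_cast; ring
  constructor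
  · intro hlt
    have : ((termSign ε (P k.castSucc) * termSign ε (P k.succ) : ℤ) : ℝ) < 0 := by
      rw [hcast]
      by_contra hge
      push Not at hge
      have := mul_nonpos_of_nonneg_of_nonpos hge hlt.le
      linarith
    exact_mod_cast this
  · intro hlt
    have hlt' : (termSign ε (P k.castSucc) : ℝ) * (termSign ε (P k.succ) : ℝ) < 0 := by
      rw [← hcast]; exact_mod_cast hlt
    by_contra hge
    push Not at hge
    have := mul_nonpos_of_nonpos_of_nonneg hlt'.le hge
    linarith

end Summit.ValiantsHypothesis.ValiantsHypothesis.Theorems.KPlusLogSqLaw.ExactPatchwork
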